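import Literature.IUT.LogThetaLattice.PacketLogVolumes
import HarnessLib

/-!
# [IUTchIII] Proposition 3.9 — proofs (companion of `PacketLogVolumes.lean`)

Proof-only companion (abc-iut cell, DISCHARGE-L6 §E2 LIST A, item A3) of
`Literature/IUT/LogThetaLattice/PacketLogVolumes.lean` (S. Mochizuki, *Inter-universal Teichmüller
theory III*, kurims manuscript (May 2020), §3, Proposition 3.9 pp. 115–117; claim key
Mochizuki2012, DISPUTED, D-0012). No new definitions.

* **IUTchIII:Prop3.9(i)** (pp. 115–116): every printed clause typed in the file is ALREADY PROVED
  there (`packetLogVolume_integralStructure` — log-volume of the integral structures is `0`;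
  `packetLogVolume_packetNormalized` / `packetLogVolume_packetNormalized_arch` — packet-normalization
  at `p_v` / at `e`; `packetLogVolume_perm` — invariance under permutations of `A`). Here in
  addition: additivity of the packet log-volume in the weights and its vanishing for zero weights
  (bookkeeping used when packets are re-indexed).
* **IUTchIII:Prop3.9(iii)** (p. 117): the global log-volume `μ^log_{A,𝕍_ℚ} = Σ_{v_ℚ} μ^log_{A,v_ℚ}`
  (`globalLogVolume`, REAL) — its two printed properties, typed over abstract data as
  `Prop39iii_invariance` (invariance under `(†𝕄⊛_mod)_α`, "product formula") and `Prop39iii_degree`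
  (equality with the arithmetic degree "relative to a suitable normalization"), are DISCHARGED here
  FROM their local forms: a place-by-place product formula `Σ_{v_ℚ} c_f(v_ℚ) = 0` gives invariance
  (`Prop39iii_invariance_of_productFormula`), and local log-volumes equal to `c ·` local degrees
  give the global identity (`Prop39iii_degree_of_local`). The unconditional instances NEED the
  bridge from `GlobalRegion`/`globalLogVolume` to the Arakelov-divisor degree of
  `Literature/IUT/LogVolume/ArakelovDivisors.lean` (abc-iut-c312-3 / abc-iut-S2), i.e. a model of
  `regionOf`, `act`, `deg` — a definition, hence not in this proof-only file.
* Prop 3.9 (ii), (iv): `Prop39ii_monoAnalyticCompat`, `Prop39iv_a`, `Prop39iv_b` are predicates /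
  data types over abstract inputs (SLOTS).
-/

namespace Literature.IUT.LogThetaLattice

open MeasureTheory Finset

universe u v

/-! ### Proposition 3.9 (i): bookkeeping -/

section PacketLogVolume

variable {ι : Type u} [Fintype ι] {k : ι → Type v} [∀ i, MeasurableSpace (k i)]

/-- **IUTchIII:Prop3.9(i)** (p. 115), bookkeeping: the packet log-volume is additive in the weight
vector (used when the normalized weights of Remark 3.1.1 (ii)–(iv) are assembled from summands).
[claim: Mochizuki2012, status: disputed] -/
theorem packetLogVolume_add_weights (w w' : ι → ℝ) (μ : ∀ i, Measure (k i)) (T : ∀ i, Set (k i)) :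
    packetLogVolume (w + w') μ T = packetLogVolume w μ T + packetLogVolume w' μ T := by
  simp only [packetLogVolume, Pi.add_apply, add_mul, Finset.sum_add_distrib]

/-- **IUTchIII:Prop3.9(i)** (p. 115), bookkeeping: the packet log-volume is homogeneous in the
weight vector. [claim: Mochizuki2012, status: disputed] -/
theorem packetLogVolume_smul_weights (c : ℝ) (w : ι → ℝ) (μ : ∀ i, Measure (k i))
    (T : ∀ i, Set (k i)) : packetLogVolume (c • w) μ T = c * packetLogVolume w μ T := by
  simp only [packetLogVolume, Pi.smul_apply, smul_eq_mul, mul_assoc, Finset.mul_sum]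

/-- **IUTchIII:Prop3.9(i)** (p. 115): with all weights zero the packet log-volume vanishes.
[claim: Mochizuki2012, status: disputed] -/
theorem packetLogVolume_zero_weights (μ : ∀ i, Measure (k i)) (T : ∀ i, Set (k i)) :
    packetLogVolume (0 : ι → ℝ) μ T = 0 := by
  simp [packetLogVolume]

end PacketLogVolume

/-! ### Proposition 3.9 (iii): global log-volumes from local data -/

section Global

variable {VQ : Type u} {Region : VQ → Type v}

/-- The global log-volume of a global region is the finite sum of its local log-volumes over the
(finite) support ([IUTchIII] Proposition 3.9 (iii), p. 117: "by adding the log-volumes … [all but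
finitely many of which are zero!]"). [claim: Mochizuki2012, status: disputed] -/
theorem globalLogVolume_eq_sum (μlog : ∀ vQ, Region vQ → ℝ) (S : GlobalRegion μlog) :
    globalLogVolume μlog S = ∑ vQ ∈ S.2.toFinset, μlog vQ (S.1 vQ) :=
  finsum_eq_sum_of_support_subset _ (by simp)

/-- **IUTchIII:Prop3.9(iii)** (p. 117), invariance DISCHARGED from the product formula: if an
action of `F` (the nonzero elements of `(†𝕄⊛_mod)_α`) on global regions changes the local log-volume
at `v_ℚ` by `c_f(v_ℚ)`, where `c_f` is finitely supported with `Σ_{v_ℚ} c_f(v_ℚ) = 0` (the product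
formula for `f`), then the global log-volume is invariant (`Prop39iii_invariance μlog act`).
[claim: Mochizuki2012, status: disputed] -/
theorem Prop39iii_invariance_of_productFormula {F : Type*} (μlog : ∀ vQ, Region vQ → ℝ)
    (act : F → GlobalRegion μlog → GlobalRegion μlog) (c : F → VQ → ℝ)
    (hc : ∀ f, (Function.support (c f)).Finite) (hsum : ∀ f, ∑ᶠ vQ, c f vQ = 0)
    (hloc : ∀ f (S : GlobalRegion μlog) vQ, μlog vQ ((act f S).1 vQ) = μlog vQ (S.1 vQ) + c f vQ) :
    Prop39iii_invariance μlog act := by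
  intro f S
  simp only [globalLogVolume, hloc]
  rw [finsum_add_distrib S.2 (hc f), hsum, add_zero]

/-- **IUTchIII:Prop3.9(iii)** (p. 117), degree comparison DISCHARGED from its local form: if the
arithmetic degree of an object `𝔍` is the sum of finitely supported local degrees `d_𝔍(v_ℚ)` and the
local log-volume of the region of `𝔍` at `v_ℚ` is `c · d_𝔍(v_ℚ)` for a fixed normalization constant
`c > 0`, then "the global log-volume `μ^log_{A,𝕍_ℚ}(𝔍)` is equal to the degree of the arithmetic line
bundle determined by `𝔍` … relative to a suitable normalization" (`Prop39iii_degree μlog regionOf deg`).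
[claim: Mochizuki2012, status: disputed] -/
theorem Prop39iii_degree_of_local {Obj : Type*} (μlog : ∀ vQ, Region vQ → ℝ)
    (regionOf : Obj → GlobalRegion μlog) (d : Obj → VQ → ℝ)
    (hd : ∀ J, (Function.support (d J)).Finite) (c : ℝ) (hc : 0 < c)
    (hloc : ∀ J vQ, μlog vQ ((regionOf J).1 vQ) = c * d J vQ) :
    Prop39iii_degree μlog regionOf fun J => ∑ᶠ vQ, d J vQ := by
  refine ⟨c, hc, fun J => ?_⟩
  simp only [globalLogVolume, hloc]
  exact (mul_finsum' _ c (hd J)).symm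

/-- **IUTchIII:Prop3.9(iii)** (p. 117): the global log-volume of a region all of whose local
log-volumes vanish (e.g. the product of the local integral structures, Proposition 3.9 (i)) is `0`.
[claim: Mochizuki2012, status: disputed] -/
theorem globalLogVolume_eq_zero_of_local (μlog : ∀ vQ, Region vQ → ℝ) (S : GlobalRegion μlog)
    (h : ∀ vQ, μlog vQ (S.1 vQ) = 0) : globalLogVolume μlog S = 0 := by
  simp [globalLogVolume, h]

end Global

end Literature.IUT.LogThetaLattice
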